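import Mathlib.NumberTheory.Padics.PadicVal.Basic
import Mathlib.Data.Nat.Factorization.Basic
import HarnessLib

/-!
# Leaf `CornerF ∧ p ramified in K` (K12r): certificate-record schema, PART I — the INERT
# `3`-Tamagawa exponent `t_cs` of a K12r@3 class (cell `bsd-print-cfram`, typer seat `ty3`;
# addendum to `X12/CMRamifiedRecordSchemaF.lean`, consumed by the displays `X12/CMRamifiedTcsThree*.lean`
# and by the MEANING file `X12/CMRamifiedRecordSchemaIMeaning.lean`)

HONEST FRAMING (cell `bsd-print-cfram`, run/shared/lean/pub/bsd-print-cfram/, verbatim in every file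
of the cell): PARTITION currency only — the leaf counts when its class theorem is in the kernel BY
NAME, flag-free; Literature named facts are statement-only with cite tags, never sorried theorems;
every imported theorem carries its printed hypotheses verbatim; numbers, not adjectives. THIS FILE IS
DATA INFRASTRUCTURE (computable records, a decidable recheck, soundness lemmas, an elementary closed
form); nothing about any elliptic curve is asserted, no named fact is introduced, nothing is booked, no
mark moves (the leaf K12r and its `p = 3` slice stay OPEN; the regime children N / T / V of crux C1 —
route `PrintCFram`, items stmt-BirchSwinnertonDyer-20698 / -20699 / -20700 — stay OPEN).

## What `t_cs` is, its closed form, and what the kernel rechecks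

`ty2` (gen 4) displays in the carriers (IMC)₃♮ / (PR|IMC)₃♮ (`X12/O11/RamifiedEllipticUnitMechanismZpThreeGr.lean`)
the term `t_cs := ord₃ (inertTamagawaProductThree W K)` — the `3`-adic valuation of `∏ c_v(W_K)` over the
places `v ∤ 3` of `K = ℚ(√−3)` of inertia degree `2` (Pollack–Weston's `μ`-difference between the minimal
and the Greenberg anticyclotomic Selmer groups; REFEREE R0.28). PART I data (HOME/ty3/partI/, kit
j291433, PARI ‖ Sage, 919 classes, 0 mismatches) computed it class by class. THIS FILE gives the CLOSED FORM
  `t_cs(k) = [v₂(k) ∈ {0, 2} ∧ k/2^{v₂(k)} ≡ 1 (mod 4)] + #{ℓ ≥ 5 prime : ℓ ≡ 2 (mod 3), v_ℓ(k) mod 6 ∈ {2, 4}}`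
for `W ≅ E_k : y² = x³ + k` (`tcsClosedForm`: the `2`-adic bit is «type IV / IV* at `2`» by the tree's
table `MordellCurveTateAlgorithmTwoProofs`, the count is the primes `ℓ ≥ 5` inert in `K` of type IV / IV*,
tree `X12/CubicModelKodaira`), its computable twin `tcsOfFactors k kf` on a certified prime factorisation
`kf` of `|k|` (bridge `tcsOfFactors_eq_tcsClosedForm`), and the record `TcsRow` whose recheck
(`TcsRow.consistent`) demands: `kf` is the factorisation of `|k|` (trial division, distinct bases),
`k ≠ 0` sixth-power-free, `letter ≤ 3`, `tcs = tcsOfFactors k kf = #{places with 3 ∣ c_v(W_K)}`, the LIST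
of inert bad primes `=` the closed-form list (`inertBadPrimes`), and per place: the Kodaira code of BOTH
members `=` the closed-form code `kodCodeAt` (codes `0` good, `1` II, `2` IV, `3` I₀*, `4` IV*, `5` II*),
`c_v(W_K) = cKOfCode` (`3` at IV/IV*, `4` at I₀*, `1` at II/II*) and the `ℚ`-side pair as Tate's algorithm
predicts at an inert prime. NOT rechecked: the PART F join (`k`, letter, window) and the VALUES `4` / `2, 2`
(engine data). The MEANING file `X12/CMRamifiedRecordSchemaIMeaning.lean` PROVES, for every `W/ℚ` with
`C • W = (y² = x³ + k)` and every imaginary quadratic `K` with `d_K = −3`,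
`padicValNat 3 (inertTamagawaProductThree W K) = tcsClosedForm k`: a consistent row displays `t_cs` BY NAME.

References: `X12/CMRamifiedRecordSchemaF.lean` (PART F), `X12/O11/RamifiedEllipticUnitMechanismZpThreeGr.lean`
(ty2 g4, `inertTamagawaProductThree`), HOME/ty3/CERT-TABLE-K12r.md §PART I, REFEREE.md R0.28;
[PollackWeston2011] Def. 3.3, Lemma 3.4, Prop. 3.7 (arXiv:math/0610694 pp. 7–8);
[SilvermanATAEC1994] IV.9.4 and Table 4.1.
-/

set_option autoImplicit false

namespace Summit.BirchSwinnertonDyer.Rank1Residual.X12.CMRamifiedRecords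

/-! ### §1 Certified prime factorisations -/

/-- Primality by trial division over `List.range` (kernel-decidable). [folklore] -/
def isPrimeB (p : ℕ) : Bool :=
  decide (2 ≤ p) && (List.range p).all fun d => decide (d < 2 ∨ p % d ≠ 0)

/-- Trial division decides primality. [folklore] -/
theorem isPrimeB_iff (p : ℕ) : isPrimeB p = true ↔ p.Prime := by
  rw [isPrimeB, Bool.and_eq_true, decide_eq_true_iff, List.all_eq_true, Nat.prime_def_lt]
  simp only [List.mem_range, decide_eq_true_iff]
  constructor
  · rintro ⟨h2, h⟩
    refine ⟨h2, fun m hm hdvd => ?_⟩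
    rcases h m hm with hlt | hmod
    · interval_cases m
      · exact absurd (zero_dvd_iff.1 hdvd) (by omega)
      · rfl
    · exact absurd (Nat.mod_eq_zero_of_dvd hdvd) hmod
  · rintro ⟨h2, h⟩
    refine ⟨h2, fun m hm => ?_⟩
    by_cases hm2 : m < 2
    · exact Or.inl hm2
    · refine Or.inr fun hmod => ?_
      have := h m hm (Nat.dvd_of_mod_eq_zero hmod)
      omega

/-- The product `∏ q^e` of a factor list. [folklore] -/
def fprod (fs : List (ℕ × ℕ)) : ℕ := (fs.map fun qe => qe.1 ^ qe.2).prod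

/-- The exponent of `ℓ` in a factor list (sum over the entries with base `ℓ`; `0` if absent). [folklore] -/
def expOf (fs : List (ℕ × ℕ)) (ℓ : ℕ) : ℕ := (fs.map fun qe => if qe.1 = ℓ then qe.2 else 0).sum

/-- `fs` is the prime factorisation of `n`: prime bases (trial division), pairwise distinct, exponents
`≥ 1`, product `n`. [folklore] -/
def factorsCheck (n : ℕ) (fs : List (ℕ × ℕ)) : Bool :=
  fs.all (fun qe => isPrimeB qe.1 && decide (1 ≤ qe.2)) && decide ((fs.map Prod.fst).Nodup) &&
    (fprod fs == n)

/-- **Soundness of `factorsCheck`** (its `Prop` content, as a conjunction): prime bases, exponents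
`≥ 1`, distinct bases, product `n`. [folklore] -/
theorem factorsCheck_sound {n : ℕ} {fs : List (ℕ × ℕ)} (h : factorsCheck n fs = true) :
    (∀ qe ∈ fs, qe.1.Prime) ∧ (∀ qe ∈ fs, 1 ≤ qe.2) ∧ (fs.map Prod.fst).Nodup ∧ fprod fs = n := by
  simp only [factorsCheck, Bool.and_eq_true, List.all_eq_true, decide_eq_true_eq, beq_iff_eq] at h
  obtain ⟨⟨hall, hnd⟩, hprod⟩ := h
  exact ⟨fun qe hqe => (isPrimeB_iff _).1 (hall qe hqe).1, fun qe hqe => (hall qe hqe).2, hnd, hprod⟩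

/-- `fprod [] = 1`. [folklore] -/
@[simp] theorem fprod_nil : fprod [] = 1 := rfl

/-- `fprod` of a cons. [folklore] -/
@[simp] theorem fprod_cons (qe : ℕ × ℕ) (fs : List (ℕ × ℕ)) :
    fprod (qe :: fs) = qe.1 ^ qe.2 * fprod fs := by
  simp [fprod]

/-- `expOf [] ℓ = 0`. [folklore] -/
@[simp] theorem expOf_nil (ℓ : ℕ) : expOf [] ℓ = 0 := rfl

/-- `expOf` of a cons. [folklore] -/
@[simp] theorem expOf_cons (qe : ℕ × ℕ) (fs : List (ℕ × ℕ)) (ℓ : ℕ) :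
    expOf (qe :: fs) ℓ = (if qe.1 = ℓ then qe.2 else 0) + expOf fs ℓ := by
  simp [expOf]

/-- A product of prime powers is non-zero. [folklore] -/
theorem fprod_ne_zero {fs : List (ℕ × ℕ)} (hp : ∀ qe ∈ fs, qe.1.Prime) : fprod fs ≠ 0 := by
  induction fs with
  | nil => simp
  | cons qe fs ih =>
    rw [fprod_cons]
    exact mul_ne_zero (pow_ne_zero _ (hp qe (by simp)).ne_zero) (ih fun qe' h => hp qe' (by simp [h]))

/-- **The exponents of a prime-power product**: `(∏ q^e).factorization ℓ = expOf fs ℓ` for every `ℓ`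
(no distinctness needed). [folklore] -/
theorem factorization_fprod {fs : List (ℕ × ℕ)} (hp : ∀ qe ∈ fs, qe.1.Prime) (ℓ : ℕ) :
    (fprod fs).factorization ℓ = expOf fs ℓ := by
  induction fs with
  | nil => simp
  | cons qe fs ih =>
    have hq : qe.1.Prime := hp qe (by simp)
    have hp' : ∀ qe' ∈ fs, qe'.1.Prime := fun qe' h => hp qe' (by simp [h])
    rw [fprod_cons, expOf_cons, Nat.factorization_mul (pow_ne_zero _ hq.ne_zero) (fprod_ne_zero hp'),
      Finsupp.add_apply, ih hp', Nat.factorization_pow, Finsupp.smul_apply, hq.factorization,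
      smul_eq_mul]
    by_cases h : qe.1 = ℓ
    · subst h; simp
    · simp [h]

/-- The exponent of `ℓ` in `n` is the listed one. [folklore] -/
theorem factorization_eq_expOf_of_factorsCheck {n : ℕ} {fs : List (ℕ × ℕ)}
    (h : factorsCheck n fs = true) (ℓ : ℕ) : n.factorization ℓ = expOf fs ℓ := by
  obtain ⟨hp, -, -, hprod⟩ := factorsCheck_sound h
  rw [← hprod]; exact factorization_fprod hp ℓ

/-- `n ≠ 0`. [folklore] -/
theorem ne_zero_of_factorsCheck {n : ℕ} {fs : List (ℕ × ℕ)} (h : factorsCheck n fs = true) : n ≠ 0 := by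
  obtain ⟨hp, -, -, hprod⟩ := factorsCheck_sound h
  rw [← hprod]; exact fprod_ne_zero hp

/-- A listed base has a positive listed exponent. [folklore] -/
theorem expOf_pos_of_mem {fs : List (ℕ × ℕ)} (hpos : ∀ qe ∈ fs, 1 ≤ qe.2) {ℓ : ℕ}
    (hℓ : ℓ ∈ fs.map Prod.fst) : 0 < expOf fs ℓ := by
  induction fs with
  | nil => simp at hℓ
  | cons qe fs ih =>
    rw [expOf_cons]
    rw [List.map_cons, List.mem_cons] at hℓ
    rcases hℓ with rfl | hℓ
    · simp only [if_true]
      have := hpos qe (by simp)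
      omega
    · have := ih (fun qe' h => hpos qe' (by simp [h])) hℓ
      omega

/-- An unlisted number has exponent `0`. [folklore] -/
theorem expOf_eq_zero_of_not_mem {fs : List (ℕ × ℕ)} {ℓ : ℕ} (hℓ : ℓ ∉ fs.map Prod.fst) :
    expOf fs ℓ = 0 := by
  induction fs with
  | nil => simp
  | cons qe fs ih =>
    rw [List.map_cons, List.mem_cons, not_or] at hℓ
    rw [expOf_cons, if_neg (Ne.symm hℓ.1), ih hℓ.2]

/-- **The listed bases are exactly the prime factors.** [folklore] -/
theorem mem_bases_iff_of_factorsCheck {n : ℕ} {fs : List (ℕ × ℕ)} (h : factorsCheck n fs = true)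
    (ℓ : ℕ) : ℓ ∈ fs.map Prod.fst ↔ ℓ ∈ n.primeFactors := by
  obtain ⟨-, hpos, -, -⟩ := factorsCheck_sound h
  rw [← Nat.support_factorization, Finsupp.mem_support_iff, factorization_eq_expOf_of_factorsCheck h]
  constructor
  · intro hℓ; exact (expOf_pos_of_mem hpos hℓ).ne'
  · intro hℓ; by_contra hmem; exact hℓ (expOf_eq_zero_of_not_mem hmem)

/-- The listed bases as a `Finset` are `n.primeFactors`. [folklore] -/
theorem toFinset_bases_of_factorsCheck {n : ℕ} {fs : List (ℕ × ℕ)} (h : factorsCheck n fs = true) :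
    (fs.map Prod.fst).toFinset = n.primeFactors := by
  ext ℓ; rw [List.mem_toFinset, mem_bases_iff_of_factorsCheck h]

/-! ### §2 The closed form of `t_cs` and the closed-form Kodaira codes -/

/-- **The `2`-adic bit**: with `a = v₂(k)` and `u = k / 2^a`, `E_k : y² = x³ + k` has Kodaira type IV
(`a = 0`) or IV* (`a = 2`) at `2` iff `a ∈ {0, 2}` and `u ≡ 1 (mod 4)` (tree
`MordellCurveTateAlgorithmTwoProofs`: the table of the nine `2`-adic cases, `64 ∤ k`). Here `a` is an
argument (the display feeds `expOf kf 2`, the closed form feeds `v₂(k)`). [cite: SilvermanATAEC1994, IV.9.4 and Table 4.1] -/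
def twoAdicIVBit (k : ℤ) (a : ℕ) : ℕ :=
  if (a = 0 ∨ a = 2) ∧ (k / (2 : ℤ) ^ a) % 4 = 1 then 1 else 0

/-- **The closed-form Kodaira code of `E_k` at a prime `ℓ`** from `a = v_ℓ(k)` (and `u = k / 2^a` at
`ℓ = 2`): codes `0` good, `1` II, `2` IV, `3` I₀*, `4` IV*, `5` II*. At `ℓ ≥ 5` the code is `a mod 6`
(Tate's algorithm on `y² = x³ + b`, `ord b = s`: tree `kodairaSymbolAt_of_cubic_model`); at `ℓ = 2` it is
the tree's table (`k = 2ᵃu`, `u` odd, `a ≤ 5`): `u ↦ IV / II` as `u ≡ 1 / 3 (4)`, `2u ↦ II`,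
`4u ↦ IV* / I₀*`, `8u ↦ I₀*`, `16u ↦ good / II*`, `32u ↦ II*`. (`ℓ = 3` is not an inert prime and is not
read.) [cite: SilvermanATAEC1994, IV.9.4 and Table 4.1] -/
def kodCodeAt (k : ℤ) (ℓ a : ℕ) : ℕ :=
  if ℓ = 2 then
    (if a = 0 then (if (k % 4) = 1 then 2 else 1)
     else if a = 1 then 1
     else if a = 2 then (if (k / 4) % 4 = 1 then 4 else 3)
     else if a = 3 then 3
     else if a = 4 then (if (k / 16) % 4 = 1 then 0 else 5)
     else if a = 5 then 5 else 0)
  else a % 6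

/-- The Tamagawa number `c_v(W_K)` the engines report at an INERT place of Kodaira code `code`:
`3` at IV / IV* (tree: `c_w = 3` above an unramified place of even residue degree), `4` at I₀*, `1` at
II / II* (data-level for the values `4`, `1`; the MEANING file certifies `ord₃`). [folklore] -/
def cKOfCode (code : ℕ) : ℕ :=
  if code = 2 ∨ code = 4 then 3 else if code = 3 then 4 else 1

/-- Is the Kodaira code one of IV / IV* (the `3 ∣ c_v(W_K)` cases)? [folklore] -/
def isIVCode (code : ℕ) : Bool := code == 2 || code == 4

/-- **`t_cs` from a certified factor list**: the `2`-adic bit plus the number of listed primes `ℓ ≥ 5`,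
`ℓ ≡ 2 (mod 3)` (inert in `ℚ(√−3)`), with exponent `≡ 2, 4 (mod 6)` (Kodaira IV / IV*). [folklore] -/
def tcsOfFactors (k : ℤ) (kf : List (ℕ × ℕ)) : ℕ :=
  twoAdicIVBit k (expOf kf 2) +
    ((kf.map Prod.fst).filter fun ℓ =>
      decide (5 ≤ ℓ ∧ ℓ % 3 = 2 ∧ (expOf kf ℓ % 6 = 2 ∨ expOf kf ℓ % 6 = 4))).length

/-- **THE CLOSED FORM `t_cs(k)`** (module docstring), on the prime factorisation of `|k|`:
`[v₂(k) ∈ {0,2} ∧ k/2^{v₂(k)} ≡ 1 (4)] + #{ℓ ≥ 5 : ℓ ∣ k, ℓ ≡ 2 (3), v_ℓ(k) mod 6 ∈ {2,4}}`. This is the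
quantity the MEANING file identifies with `ord₃ (inertTamagawaProductThree W K)`. [folklore] -/
def tcsClosedForm (k : ℤ) : ℕ :=
  twoAdicIVBit k (k.natAbs.factorization 2) +
    (k.natAbs.primeFactors.filter fun ℓ =>
      5 ≤ ℓ ∧ ℓ % 3 = 2 ∧ (k.natAbs.factorization ℓ % 6 = 2 ∨ k.natAbs.factorization ℓ % 6 = 4)).card

/-- **Bridge**: on a certified factorisation of `|k|`, the list form IS the closed form. [folklore] -/
theorem tcsOfFactors_eq_tcsClosedForm {k : ℤ} {kf : List (ℕ × ℕ)} (h : factorsCheck k.natAbs kf = true) :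
    tcsOfFactors k kf = tcsClosedForm k := by
  obtain ⟨-, -, hnd, -⟩ := factorsCheck_sound h
  rw [tcsOfFactors, tcsClosedForm, ← factorization_eq_expOf_of_factorsCheck h 2,
    ← toFinset_bases_of_factorsCheck h]
  congr 1
  rw [← List.toFinset_card_of_nodup (hnd.filter _), List.toFinset_filter]
  congr 1
  ext ℓ
  simp only [Finset.mem_filter, List.mem_toFinset, decide_eq_true_eq,
    factorization_eq_expOf_of_factorsCheck h]

/-- The closed-form list of INERT bad primes of `E_k` (`K = ℚ(√−3)`): `2` iff `E_k` is bad at `2`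
(code `≠ 0`), followed by the listed primes `ℓ ≥ 5` with `ℓ ≡ 2 (mod 3)` (all bad: additive), in the
order of `kf`. [folklore] -/
def inertBadPrimes (k : ℤ) (kf : List (ℕ × ℕ)) : List ℕ :=
  (if kodCodeAt k 2 (expOf kf 2) ≠ 0 then [2] else []) ++
    ((kf.map Prod.fst).filter fun ℓ => decide (5 ≤ ℓ ∧ ℓ % 3 = 2))

/-! ### §3 The record type and its in-kernel recheck -/

/-- **One INERT bad place** of a K12r@3 class as the engines report it: the rational prime `ℓ` (inert in
`K = ℚ(√−3)`), the Kodaira codes and Tamagawa numbers of `W = E_k` and of the twin `W' = E_{k'}` over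
`ℚ_ℓ`, and `c_v(W_K)` at the place `v` of `K` above `ℓ` (`W_K ≅ W'_K`). Codes: `1` II, `2` IV, `3` I₀*,
`4` IV*, `5` II*. [folklore] -/
structure InertPlace where
  ℓ : ℕ
  kodW : ℕ
  cW : ℕ
  kodW' : ℕ
  cW' : ℕ
  cK : ℕ

/-- **`t_cs` record of a K12r@3 class** (module docstring): `W = E_k` the member of PART F (`k`
sixth-power-free, `kf` the prime factorisation of `|k|`), `letter ∈ {0 = N, 1 = T_cube, 2 = T_split, 3 = V}`
and `window` (PART F join, not rechecked), `tcs = t_cs`, and the inert bad places. [folklore] -/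
structure TcsRow where
  cls : String
  label : String
  k : ℤ
  kf : List (ℕ × ℕ)
  letter : ℕ
  window : Bool
  tcs : ℕ
  places : List InertPlace

namespace InertPlace

/-- The per-place recheck against the closed forms (module docstring): `ℓ` is `2` or `≡ 2 (mod 3)`,
the Kodaira code of both members is the closed-form code of `k` at `ℓ` and is bad, `c_v(W_K)` is the
expected value, and the `ℚ`-side pair `(c(W), c(W'))` is `{1,3}` with exactly one `3` at IV/IV*, `(2,2)`
at I₀*, `(1,1)` at II/II*. [folklore] -/
def ok (k : ℤ) (kf : List (ℕ × ℕ)) (P : InertPlace) : Bool :=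
  (P.ℓ == 2 || P.ℓ % 3 == 2) &&
  (P.kodW == kodCodeAt k P.ℓ (expOf kf P.ℓ)) && (P.kodW != 0) && (P.kodW' == P.kodW) &&
  (P.cK == cKOfCode P.kodW) &&
  (if isIVCode P.kodW then (P.cW == 3 && P.cW' == 1) || (P.cW == 1 && P.cW' == 3)
   else if P.kodW == 3 then P.cW == 2 && P.cW' == 2
   else P.cW == 1 && P.cW' == 1)

end InertPlace

namespace TcsRow

/-- Block 1 (the coefficient): `kf` is the prime factorisation of `|k|`, `k ≠ 0`, `64 ∤ k`,
sixth-power-free (every exponent `≤ 5`), `letter ≤ 3`. [folklore] -/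
def shapeOK (r : TcsRow) : Bool :=
  factorsCheck r.k.natAbs r.kf && (r.k != 0) && (r.k % 64 != 0) &&
    (r.kf.all fun qe => decide (qe.2 ≤ 5)) && decide (r.letter ≤ 3)

/-- Block 2 (`t_cs`): `tcs` is the closed form AND the number of displayed places with `3 ∣ c_v(W_K)`.
[folklore] -/
def tcsOK (r : TcsRow) : Bool :=
  (r.tcs == tcsOfFactors r.k r.kf) && (r.tcs == (r.places.filter fun P => P.cK % 3 == 0).length)

/-- Block 3 (the places): the displayed inert bad primes are the closed-form list, and every place
passes `InertPlace.ok`. [folklore] -/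
def placesOK (r : TcsRow) : Bool :=
  ((r.places.map InertPlace.ℓ) == inertBadPrimes r.k r.kf) && r.places.all (InertPlace.ok r.k r.kf)

/-- **The in-kernel recheck of a `TcsRow`**: the three blocks. [folklore] -/
def consistent (r : TcsRow) : Bool :=
  r.shapeOK && r.tcsOK && r.placesOK

/-- `consistent` unpacked. [folklore] -/
theorem consistent_iff (r : TcsRow) :
    r.consistent = true ↔ r.shapeOK = true ∧ r.tcsOK = true ∧ r.placesOK = true := by
  simp only [consistent, Bool.and_eq_true]
  tauto

end TcsRow

/-- The tally of a list of records: per letter `N, T_cube, T_split, V` the pair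
`(#rows, #rows with t_cs ≥ 1)`, then the pair for the window rows (`N < 2·10⁴`) of letters N and T.
[folklore] -/
def tcsTally (rs : List TcsRow) : (ℕ × ℕ) × (ℕ × ℕ) × (ℕ × ℕ) × (ℕ × ℕ) × (ℕ × ℕ) × (ℕ × ℕ) :=
  let cnt : (TcsRow → Bool) → ℕ × ℕ := fun p =>
    ((rs.filter p).length, (rs.filter fun r => p r && decide (1 ≤ r.tcs)).length)
  (cnt fun r => r.letter == 0, cnt fun r => r.letter == 1, cnt fun r => r.letter == 2,
    cnt fun r => r.letter == 3, cnt fun r => r.window && r.letter == 0,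
    cnt fun r => r.window && (r.letter == 1 || r.letter == 2))

/-- What a display file checks by `decide`: every record consistent AND the tally as stated. [folklore] -/
def tcsCheck (rs : List TcsRow) (t : (ℕ × ℕ) × (ℕ × ℕ) × (ℕ × ℕ) × (ℕ × ℕ) × (ℕ × ℕ) × (ℕ × ℕ)) : Bool :=
  rs.all TcsRow.consistent && (tcsTally rs == t)

/-- Unpacking `tcsCheck`. [folklore] -/
theorem tcsCheck_iff (rs : List TcsRow) (t : (ℕ × ℕ) × (ℕ × ℕ) × (ℕ × ℕ) × (ℕ × ℕ) × (ℕ × ℕ) × (ℕ × ℕ)) :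
    tcsCheck rs t = true ↔ rs.all TcsRow.consistent = true ∧ tcsTally rs = t := by
  simp only [tcsCheck, Bool.and_eq_true, beq_iff_eq]

/-- Unpacking a display theorem per member. [folklore] -/
theorem TcsRow.consistent_of_tcsCheck {rs : List TcsRow}
    {t : (ℕ × ℕ) × (ℕ × ℕ) × (ℕ × ℕ) × (ℕ × ℕ) × (ℕ × ℕ) × (ℕ × ℕ)}
    (h : tcsCheck rs t = true) {r : TcsRow} (hr : r ∈ rs) : r.consistent = true :=
  List.all_eq_true.1 ((tcsCheck_iff rs t).1 h).1 r hr

/-! ### §4 Soundness of a consistent record -/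

namespace TcsRow

/-- A consistent record carries a certified factorisation of `|k|`, `k ≠ 0`, and `64 ∤ k`. [folklore] -/
theorem factorsCheck_of_consistent {r : TcsRow} (h : r.consistent = true) :
    factorsCheck r.k.natAbs r.kf = true ∧ r.k ≠ 0 ∧ ¬ (64 : ℤ) ∣ r.k := by
  obtain ⟨hs, -, -⟩ := (consistent_iff r).1 h
  simp only [shapeOK, Bool.and_eq_true, bne_iff_ne, ne_eq, List.all_eq_true, decide_eq_true_eq] at hs
  obtain ⟨⟨⟨⟨hf, hk⟩, h64⟩, -⟩, -⟩ := hs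
  exact ⟨hf, hk, fun h => h64 (Int.emod_eq_zero_of_dvd h)⟩

/-- **A consistent record displays the closed form**: `tcs = tcsClosedForm k`. [folklore] -/
theorem tcs_eq_tcsClosedForm_of_consistent {r : TcsRow} (h : r.consistent = true) :
    r.tcs = tcsClosedForm r.k := by
  obtain ⟨-, ht, -⟩ := (consistent_iff r).1 h
  simp only [tcsOK, Bool.and_eq_true, beq_iff_eq] at ht
  rw [ht.1, tcsOfFactors_eq_tcsClosedForm (factorsCheck_of_consistent h).1]

/-- A consistent record's `tcs` is also the number of displayed places with `3 ∣ c_v(W_K)`, and its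
displayed inert bad primes are the closed-form list. [folklore] -/
theorem places_spec_of_consistent {r : TcsRow} (h : r.consistent = true) :
    r.tcs = (r.places.filter fun P => P.cK % 3 == 0).length ∧
      r.places.map InertPlace.ℓ = inertBadPrimes r.k r.kf ∧
      ∀ P ∈ r.places, P.ok r.k r.kf = true := by
  obtain ⟨-, ht, hp⟩ := (consistent_iff r).1 h
  simp only [tcsOK, Bool.and_eq_true, beq_iff_eq] at ht
  simp only [placesOK, Bool.and_eq_true, beq_iff_eq, List.all_eq_true] at hp
  exact ⟨ht.2, hp.1, hp.2⟩

end TcsRow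

end Summit.BirchSwinnertonDyer.Rank1Residual.X12.CMRamifiedRecords
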